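import Literature.MathematicalPhysics.QuantumLattice.QuasiLocalAlgebra
import Mathlib.MeasureTheory.Integral.IntervalIntegral.FundThmCalculus
import Mathlib.Analysis.Calculus.Deriv.Shift
import Mathlib.Analysis.CStarAlgebra.Spectrum
import HarnessLib

/-!
# Discharged facts: the quasi-local algebra (`QuasiLocalAlgebra`)

`Literature.MathematicalPhysics.QuantumLattice.QuasiLocalAlgebra` records, among other things,
the C⋆-algebraic ground-state condition `Literature.State.IsGroundState ω τ`
(`-i ω(a⋆ δ(a)) ≥ 0` for every `a` in the domain of the generator `δ` of the strongly
continuous automorphism group `τ`; Bratteli–Robinson II Def. 5.3.18, Sakai Def. 4.2.1) and the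
named fact

* `Literature.MathematicalPhysics.QuantumLattice.State.IsGroundState.apply_dynamics` — *a ground state is `τ`-invariant*,
  `ω (τ t a) = ω a` (Bratteli–Robinson II Prop. 5.3.19; Sakai, *Operator Algebras in
  Dynamical Systems* (1991), Prop. 4.2.2, p. 107: "A ground state `φ` for `α` is invariant under
  `α` – i.e. `φ(α_t(a)) = φ(a)` (`t ∈ ℝ`, `a ∈ A`)").

This file proves it: `Literature.MathematicalPhysics.QuantumLattice.State.IsGroundState.apply_dynamics_holds`, so that users holding
`(h : State.IsGroundState.apply_dynamics)` can discharge the hypothesis.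

It also discharges the named fact

* `Literature.MathematicalPhysics.QuantumLattice.QuasiLocalAlgebra.isTranslationInvariant_iff` — *a state of the quasi-local
  algebra is translation invariant iff its family of local states is*
  (Bratteli–Robinson II §6.2.1, eqs. (6.2.1)–(6.2.2)),

as `Literature.MathematicalPhysics.QuantumLattice.QuasiLocalAlgebra.isTranslationInvariant_iff_holds`, via the injectivity of
`State.toInfVolState` (`Literature.MathematicalPhysics.QuantumLattice.State.toInfVolState_injective`: states agreeing on the norm-dense
local algebra `⋃_Λ ι_Λ(𝔄_Λ)` are equal, by automatic continuity of states, Bratteli–Robinson I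
Prop. 2.3.11) and the already proved `State.toInfVolState_comap_shift`
(`(ω ∘ τ_v)_Λ = shift v (ω_Λ)`).

## Proof

Sakai's printed proof (p. 107): for `a ∈ D(δ)` and `λ ∈ ℂ`, `a + λ1 ∈ D(δ)` with
`δ(a + λ1) = δ(a)`, so `-i ω((a + λ1)⋆ δ(a)) = -i ω(a⋆ δ a) - i λ̄ ω(δ a) ≥ 0`; hence
`-i λ̄ ω(δ a)` is real for all `λ`, i.e. `ω(δ a) = 0` on `D(δ)`; then `ω ∘ α_t = ω` on the
(dense) analytic elements and by continuity everywhere.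

We follow the first half verbatim (`State.IsGroundState.apply_eq_zero_of_hasDerivAt`, using
`λ = 1` and `λ = -i`, i.e. the pairs `(1 + b, δb)` and `(1 + i b, i δb)` in the graph of `δ`).
For the second half we avoid both the density of `D(δ)` and the continuity of `ω` (the fact is
stated over a bare `[PartialOrder A]`, where automatic continuity of positive functionals is not
available) by the standard smoothing identity for strongly continuous one-parameter groups
(the usual proof that a generator is densely defined): for every `a ∈ A` and `t ∈ ℝ` the
Bochner integral `x = ∫₀ᵗ τ_s(a) ds` lies in `D(δ)` with `δ(x) = τ_t(a) - a`
(`IsAutomorphismGroup.hasDerivAt_integral`: `τ_h(x) = ∫ₕ^{h+t} τ_s(a) ds` because the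
continuous linear map `τ_h` commutes with the integral and `τ_h τ_s = τ_{h+s}`, and the
fundamental theorem of calculus, Mathlib `Continuous.integral_hasStrictDerivAt`). Hence
`ω(τ_t a) - ω(a) = ω(δ x) = 0` by linearity of `ω` alone.

Continuity of `a ↦ τ_h(a)` is Mathlib's automatic continuity of ⋆-homomorphisms between
C⋆-algebras (`NonUnitalStarAlgHom.instContinuousLinearMapClassComplex`, scoped instance in
`CStarAlgebra`).

## References

* O. Bratteli, D. W. Robinson, *Operator Algebras and Quantum Statistical Mechanics II*
  (2nd ed., Springer 1997), Def. 5.3.18, Prop. 5.3.19; §6.2.1, eqs. (6.2.1)–(6.2.2) (quantum spin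
  systems, space translations `τ_x(𝔄_Λ) = 𝔄_{Λ+x}`). [BratteliRobinsonII1997]
* S. Sakai, *Operator Algebras in Dynamical Systems* (Cambridge University Press 1991), §4.2,
  Def. 4.2.1, Prop. 4.2.2 (p. 107). [Sakai1991]
* O. Bratteli, D. W. Robinson, *Operator Algebras and Quantum Statistical Mechanics I*
  (2nd ed., Springer 1987), Def. 2.7.1 (C⋆-dynamical systems), Prop. 2.3.11 (continuity of
  states), Def. 2.6.3 (quasi-local algebras).
-/

noncomputable section

open Complex Filter Topology
open scoped ComplexOrder CStarAlgebra

namespace Literature.MathematicalPhysics.QuantumLattice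

section CStar

variable {A : Type*} [CStarAlgebra A]

namespace IsAutomorphismGroup

variable {τ : ℝ → (A ≃⋆ₐ[ℂ] A)}

/-- `τ₀ = id`, applied form. Bratteli–Robinson I Def. 2.7.1. [folklore] -/
theorem map_zero_apply (hτ : IsAutomorphismGroup τ) (a : A) : τ 0 a = a := by
  rw [hτ.1]; rfl

/-- The group law `τ_{s+t}(a) = τ_s(τ_t(a))`, applied form. Bratteli–Robinson I Def. 2.7.1.
[folklore] -/
theorem map_add_apply (hτ : IsAutomorphismGroup τ) (s t : ℝ) (a : A) :
    τ (s + t) a = τ s (τ t a) := by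
  rw [hτ.2.1]; rfl

/-- Strong continuity: `t ↦ τ_t(a)` is continuous. Bratteli–Robinson I Def. 2.7.1. [folklore] -/
theorem continuous_apply (hτ : IsAutomorphismGroup τ) (a : A) : Continuous fun t : ℝ => τ t a :=
  hτ.2.2 a

/-- `τ_h` shifts the smoothing integral: `τ_h (∫₀ᵗ τ_s(a) ds) = ∫ₕ^{h+t} τ_s(a) ds`
(the continuous linear map `τ_h` commutes with the Bochner integral and `τ_h τ_s = τ_{h+s}`);
standard smoothing argument for strongly continuous groups. [folklore] -/
theorem apply_integral (hτ : IsAutomorphismGroup τ) (a : A) (h t : ℝ) :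
    τ h (∫ s in (0:ℝ)..t, τ s a) = ∫ s in h..h + t, τ s a := by
  have hcont := hτ.continuous_apply a
  -- `τ_h` as a continuous (real-)linear map: ⋆-homomorphisms between C⋆-algebras are
  -- automatically continuous (scoped instance
  -- `NonUnitalStarAlgHom.instContinuousLinearMapClassComplex`).
  obtain ⟨L, hL⟩ : ∃ L : A →L[ℝ] A, ∀ x, L x = τ h x :=
    ⟨{ ((τ h : A →⋆ₐ[ℂ] A).toLinearMap.restrictScalars ℝ) with
        cont := map_continuous (τ h : A →⋆ₐ[ℂ] A) }, fun _ => rfl⟩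
  have h1 : τ h (∫ s in (0:ℝ)..t, τ s a) = ∫ s in (0:ℝ)..t, τ h (τ s a) := by
    have := L.intervalIntegral_comp_comm (hcont.intervalIntegrable (μ := MeasureTheory.volume) 0 t)
    simpa only [hL] using this.symm
  have h2 : (∫ s in (0:ℝ)..t, τ h (τ s a)) = ∫ s in (0:ℝ)..t, τ (h + s) a := by
    congr 1 with s
    rw [hτ.map_add_apply]
  rw [h1, h2, intervalIntegral.integral_comp_add_left (fun s => τ s a) h, add_zero]

/-- **Smoothing identity.** For every `a ∈ A` and `t ∈ ℝ`, the element `x = ∫₀ᵗ τ_s(a) ds`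
lies in the domain of the generator `δ` of `τ` and `δ(x) = τ_t(a) - a`, i.e.
`h ↦ τ_h(x)` has derivative `τ_t(a) - a` at `h = 0` (from `apply_integral` and the fundamental
theorem of calculus); the standard argument that generators of strongly continuous groups are
densely defined. [folklore] -/
theorem hasDerivAt_integral (hτ : IsAutomorphismGroup τ) (a : A) (t : ℝ) :
    HasDerivAt (fun h : ℝ => τ h (∫ s in (0:ℝ)..t, τ s a)) (τ t a - a) 0 := by
  have hcont := hτ.continuous_apply a
  have hF : ∀ u : ℝ, HasDerivAt (fun u => ∫ s in (0:ℝ)..u, τ s a) (τ u a) u := fun u =>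
    (hcont.integral_hasStrictDerivAt 0 u).hasDerivAt
  have key : (fun h : ℝ => τ h (∫ s in (0:ℝ)..t, τ s a)) =
      fun h => (∫ s in (0:ℝ)..h + t, τ s a) - ∫ s in (0:ℝ)..h, τ s a := by
    funext h
    rw [hτ.apply_integral, intervalIntegral.integral_interval_sub_left (hcont.intervalIntegrable _ _)
      (hcont.intervalIntegrable _ _)]
  rw [key]
  have h1 : HasDerivAt (fun h : ℝ => ∫ s in (0:ℝ)..h + t, τ s a) (τ t a) 0 := by
    have := HasDerivAt.comp_add_const 0 t (by simpa using hF t)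
    simpa using this
  have h2 := h1.sub (hF 0)
  rwa [hτ.map_zero_apply] at h2

end IsAutomorphismGroup

variable [PartialOrder A]

/-- **A ground state annihilates the generator**: if `ω` is a ground state for `τ` and
`t ↦ τ_t(b)` has derivative `δb` at `0` (i.e. `b ∈ D(δ)`, `δ(b) = δb`), then `ω(δb) = 0`.
This is the first half of Sakai's proof of Prop. 4.2.2 (p. 107): applying the ground-state
inequality to `b + λ1 ∈ D(δ)` (`δ(b + λ1) = δ b`) shows `-i λ̄ ω(δ b)` is real for all `λ ∈ ℂ`;
here with `λ = 1` and `λ = -i`. No continuity of `ω` is used.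
[cite: Sakai1991, Prop. 4.2.2 (proof), p. 107] -/
theorem State.IsGroundState.apply_eq_zero_of_hasDerivAt {τ : ℝ → (A ≃⋆ₐ[ℂ] A)} {ω : State A}
    (hω : ω.IsGroundState τ) {b δb : A} (hb : HasDerivAt (fun t : ℝ => τ t b) δb 0) :
    ω δb = 0 := by
  have re_eq : ∀ (a δa : A), HasDerivAt (fun t : ℝ => τ t a) δa 0 →
      (ω (star a * δa)).re = 0 := by
    intro a δa h
    have h2 := (Complex.nonneg_iff.mp (hω a δa h)).2
    simpa using h2
  have h1 : HasDerivAt (fun t : ℝ => τ t (1 + b)) δb 0 := by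
    have : (fun t : ℝ => τ t (1 + b)) = fun t => 1 + τ t b := by
      funext t; simp [map_add]
    rw [this]; exact hb.const_add 1
  have h2 : HasDerivAt (fun t : ℝ => τ t (1 + I • b)) (I • δb) 0 := by
    have : (fun t : ℝ => τ t (1 + I • b)) = fun t => 1 + I • τ t b := by
      funext t; simp [map_add, map_smul]
    rw [this]; exact (hb.fun_const_smul I).const_add 1
  have e0 := re_eq b δb hb
  have e1 := re_eq _ _ h1
  have e2 := re_eq _ _ h2
  simp only [star_add, star_one, add_mul, one_mul, map_add] at e1
  simp only [star_add, star_one, star_smul, add_mul, one_mul, mul_smul_comm,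
    smul_mul_assoc, map_add, map_smul] at e2
  apply Complex.ext
  · simp at e1 ⊢; linarith
  · simp at e2 ⊢; linarith

/-- **Discharge of `State.IsGroundState.apply_dynamics`: ground states are `τ`-invariant.**
For a strongly continuous one-parameter group `τ` of ⋆-automorphisms of a C⋆-algebra and a
ground state `ω` (`-i ω(a⋆ δ(a)) ≥ 0` on `D(δ)`), `ω (τ_t a) = ω a` for all `t ∈ ℝ`, `a ∈ A`.
Bratteli–Robinson II Prop. 5.3.19; Sakai (1991) Prop. 4.2.2, p. 107 ("A ground state `φ` for
`α` is invariant under `α`"). Proof: `ω ∘ δ = 0` on `D(δ)`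
(`State.IsGroundState.apply_eq_zero_of_hasDerivAt`) and `τ_t(a) - a = δ(∫₀ᵗ τ_s(a) ds)`
(`IsAutomorphismGroup.hasDerivAt_integral`), so `ω(τ_t a) - ω(a) = 0` by linearity.
[cite: BratteliRobinsonII1997, Prop. 5.3.19] -/
theorem State.IsGroundState.apply_dynamics_holds :
    State.IsGroundState.apply_dynamics (A := A) := by
  intro τ hτ ω hω t a
  have h := hω.apply_eq_zero_of_hasDerivAt (hτ.hasDerivAt_integral a t)
  rwa [map_sub, sub_eq_zero] at h

end CStar

/-! ### Translation-invariant states of the quasi-local algebra -/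

section QLattice

open Literature.Probability.LatticeModels
open Literature.Probability.LatticeModels (Site)

variable {d q : ℕ}

/-- **States of `𝔄` are determined by their families of local states**: `ω ↦ (ω ∘ ι_Λ)_Λ`
(`State.toInfVolState`) is injective. Two states agreeing on the norm-dense strictly local
elements `⋃_Λ ι_Λ(𝔄_Λ)` (`QuasiLocalAlgebra.dense_range`) agree everywhere, since states of a
C⋆-algebra are automatically continuous (Bratteli–Robinson I Prop. 2.3.11; Mathlib's
`ContinuousLinearMapClass` instance for positive maps between C⋆-algebras). This is the
uniqueness half of `existsUnique_state_of_infVolState`.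
Bratteli–Robinson II §6.2.1; Bratteli–Robinson I Prop. 2.3.11 and Def. 2.6.3. [folklore] -/
theorem State.toInfVolState_injective (𝔄 : QuasiLocalAlgebra d q) :
    Function.Injective (State.toInfVolState : State 𝔄.carrier → InfVolState d q) := by
  intro ω₁ ω₂ h
  have hc₁ : Continuous (ω₁ : 𝔄.carrier → ℂ) := map_continuous ω₁.toPositiveLinearMap
  have hc₂ : Continuous (ω₂ : 𝔄.carrier → ℂ) := map_continuous ω₂.toPositiveLinearMap
  refine State.ext (congrFun (Continuous.ext_on 𝔄.dense_range hc₁ hc₂ ?_))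
  intro a ha
  obtain ⟨Λ, A, rfl⟩ : ∃ (Λ : Finset (Site d)) (A : Op ↥Λ q), 𝔄.ι Λ A = a := by
    simpa [Set.mem_iUnion] using ha
  simpa using congrArg (fun ω : InfVolState d q => ω.expect Λ A) h

/-- **Discharge of `QuasiLocalAlgebra.isTranslationInvariant_iff`**: a state `ω` of the
quasi-local algebra is translation invariant (`ω ∘ τ_v = ω` for all `v ∈ ℤ^d`,
`QuasiLocalAlgebra.IsTranslationInvariant`) iff its family of local states `(ω ∘ ι_Λ)_Λ` is
(`InfVolState.IsTranslationInvariant`, `shift v ω = ω`). By `State.toInfVolState_comap_shift`,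
`(ω ∘ τ_v)_Λ = shift v (ω_Λ)` (Bratteli–Robinson II eq. (6.2.2): `τ_x(𝔄_Λ) = 𝔄_{Λ+x}`), so
`⇒` is immediate from `ω ∘ τ_v = ω`, and `⇐` is `State.toInfVolState_injective` (a state is
determined by its restrictions to the dense local algebra) applied to
`(ω ∘ τ_v)_Λ = ω_Λ` for all `Λ`. Bratteli–Robinson II §6.2.1, eqs. (6.2.1)–(6.2.2).
[cite: BratteliRobinsonII1997, §6.2.1] -/
theorem QuasiLocalAlgebra.isTranslationInvariant_iff_holds :
    QuasiLocalAlgebra.isTranslationInvariant_iff (d := d) (q := q) := by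
  intro 𝔄 ω
  have hv : ∀ v : Site d,
      ω.comap (𝔄.shift v : 𝔄.carrier →⋆ₐ[ℂ] 𝔄.carrier) = ω ↔
        ω.toInfVolState.shift v = ω.toInfVolState := by
    intro v
    rw [← State.toInfVolState_comap_shift]
    exact ⟨fun h => by rw [h], fun h => State.toInfVolState_injective 𝔄 h⟩
  constructor
  · intro h v
    exact (hv v).1 (State.ext fun a => by simpa using h v a)
  · intro h v a
    simpa using congrArg (fun ω' : State 𝔄.carrier => ω' a) ((hv v).2 (h v))

end QLattice

end Literature.MathematicalPhysics.QuantumLattice
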